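import Literature.NumberTheory.Automorphic.UnitaryGroupKernelFiniteSum
import Literature.NumberTheory.Automorphic.AdelicUnitaryGroupDatum
import Literature.NumberTheory.Automorphic.AdelicCommutativeDatumMultiplicityOne
import Literature.NumberTheory.Automorphic.UnitaryGroupQuasiSplitCMDatum
import HarnessLib

/-!
# Kernel slices on a product `G₂(𝔸) × G₁(𝔸)`: «the compact factor» of `H = U(Φ₂) × U(Φ₁)`
(Rogawski, *Automorphic Representations of Unitary Groups in Three Variables* (1990), §2.2 p. 13 «the sums
over `γ` are finite», §4.9 pp. 54–55 (`H = U(2) × U(1)`); Gelbart, *Automorphic Forms on Adele Groups* (1975),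
(9.20); Borel, *Some finiteness properties of adele groups over number fields* (1963), §5)

Topic `NumberTheory/Automorphic`; namespaces `Literature.NumberTheory.Automorphic.AdelicGroupData` (§§1–3, any pair
of adelic group data) and `Literature.NumberTheory.Automorphic.UnitaryGroup` (§4, the pair `U(J_N) × U(Φ₁)` over a
CM field). THEOREMS ONLY over accepted tree modules: no definition, no named fact, no `sorry`, no instance, no
notation. H-side copy of the trace-formula letters, census `CENSUS-LAWS-Hside` §0 item 8 ∕ §3 «the compact factor»
(D0 = «by reduction», definition-free): for a compactly supported `f` on `G₂(𝔸) × G₁(𝔸)` the SLICES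
`f_{a₁} := f(·, a₁)` are compactly supported on `G₂(𝔸)`, only FINITELY many rational `γ₁ ∈ G₁(F)` carry a
non-zero slice `f_{x₁⁻¹ γ₁ y₁}`, and the kernel sum over `G₂(F) × G₁(F)` is the honest finite sum over those
`γ₁` of the `G₂`-kernel sums of the slices; for a COMMUTATIVE second factor (the compact torus `U(Φ₁)`,
`x₁⁻¹ γ₁ x₁ = γ₁`) the diagonal kernel of the pair is `Σ_{γ₁} K_{G₂}[f_{γ₁}](x₂, x₂)`.

* §1 `AdelicGroupData.finite_setOf_conj_mem_of_isCompact` — for a datum with discrete rational points and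
  Hausdorff adelic points, `{γ ∈ G(F) : x⁻¹ γ y ∈ C}` is finite for compact `C` (the generic form of ★
  `UnitaryGroup.finite_setOf_mem_arithmeticSubgroup_of_isCompact`).
* §2 slices: `continuous_slice_left∕right`, `hasCompactSupport_slice_left∕right`,
  `finite_setOf_slice_ne_zero` (finitely many `γ₁` with `f(·, x₁⁻¹ γ₁ y₁) ≠ 0`).
* §3 the pair sum: `finite_support_pair_term`, `summable_pair_term`, **`tsum_pair_eq_sum_tsum_slice`**
  (`Σ'_{(γ₂,γ₁)} f(x₂⁻¹γ₂y₂, x₁⁻¹γ₁y₁) = Σ_{γ₁ ∈ S₁} Σ'_{γ₂} f(x₂⁻¹γ₂y₂, x₁⁻¹γ₁y₁)`) and its commutative-factor form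
  **`tsum_pair_eq_sum_tsum_slice_of_comm`** (`x₁⁻¹ γ₁ x₁ = γ₁`).
* §4 `UnitaryGroup.tsum_pair_eq_sum_kernel_slice` — at `G₂ = U(J_N)` (★ `quasiSplit`, whose kernel letter is ★
  `UnitaryGroup.kernel`) and `G₁ = U(Φ₁)` (★ `cmDatum L 1 Φ₁`, commutative by ★ `cmDatum_one_mul_comm`, discrete by
  ★ `cmDatum_isDiscreteRational`): `Σ'_{(γ₂,γ₁)} f(x₂⁻¹γ₂x₂, x₁⁻¹γ₁x₁) = Σ_{γ₁ ∈ S₁} K[f_{γ₁}](x₂, x₂)`.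

## References

* J. D. Rogawski, *Automorphic Representations of Unitary Groups in Three Variables*, Annals of Mathematics Studies
  123 (1990), §2.2 p. 13, §4.9 pp. 54–55 [Rogawski1990].
* S. Gelbart, *Automorphic Forms on Adele Groups*, Annals of Mathematics Studies 83 (1975), §9 (9.20) [Gelbart1975].
* A. Borel, *Some finiteness properties of adele groups over number fields*, Publ. Math. IHÉS 16 (1963), §5
  [Borel1963].
-/

noncomputable section

open NumberField Topology Set Function

namespace Literature.NumberTheory.Automorphic

namespace AdelicGroupData

variable {K : Type} [Field K] [NumberField K]

/-! ## §1 Finitely many rational points conjugate into a compact set -/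

/-- **Only finitely many `γ ∈ G(F)` have `x⁻¹ γ y` in a compact set** `C ⊆ G(𝔸_F)`, for an adelic group datum
with discrete rational points and Hausdorff adelic points: `G(F)` is a discrete, hence closed, subgroup; the map
`g ↦ x⁻¹ g y` is a homeomorphism, so `{g : x⁻¹ g y ∈ C}` is compact, and its trace on the closed discrete `G(F)`
is compact and discrete, hence finite (Gelbart (1975), (9.20) «the sum is actually finite»; Borel (1963), §5).
[cite: Gelbart1975, (9.20)] [cite: Borel1963, §5] -/
theorem finite_setOf_conj_mem_of_isCompact {𝒢 : AdelicGroupData K} (h𝒢 : 𝒢.IsDiscreteRational)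
    [T2Space 𝒢.Adelic] {C : Set 𝒢.Adelic} (hC : IsCompact C) (x y : 𝒢.Adelic) :
    {γ : 𝒢.arithmeticSubgroup | x⁻¹ * (γ : 𝒢.Adelic) * y ∈ C}.Finite := by
  haveI : DiscreteTopology 𝒢.arithmeticSubgroup := h𝒢
  have hcl : IsClosed ((𝒢.arithmeticSubgroup : Set 𝒢.Adelic)) := Subgroup.isClosed_of_discrete
  let e : 𝒢.Adelic ≃ₜ 𝒢.Adelic := (Homeomorph.mulLeft x⁻¹).trans (Homeomorph.mulRight y)
  have he : (fun g : 𝒢.Adelic => x⁻¹ * g * y) = e := funext fun _ => rfl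
  have hK : IsCompact ((fun g : 𝒢.Adelic => x⁻¹ * g * y) ⁻¹' C) := by
    rw [he]
    exact e.isCompact_preimage.2 hC
  have hK' : IsCompact ((Subtype.val : 𝒢.arithmeticSubgroup → 𝒢.Adelic) ⁻¹'
      ((fun g : 𝒢.Adelic => x⁻¹ * g * y) ⁻¹' C)) :=
    hcl.isClosedEmbedding_subtypeVal.isCompact_preimage hK
  exact hK'.finite_of_discrete

/-! ## §2 Slices of a function on `G₂(𝔸) × G₁(𝔸)` -/

variable {𝒢₂ 𝒢₁ : AdelicGroupData K}

/-- A slice `g₂ ↦ f(g₂, a₁)` of a continuous `f` is continuous (the slices `f_{γ₁}` of Rogawski (1990), §4.9). [cite: Rogawski1990, §4.9 pp. 54–55] -/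
theorem continuous_slice_left {f : 𝒢₂.Adelic × 𝒢₁.Adelic → ℂ} (hf : Continuous f) (a₁ : 𝒢₁.Adelic) :
    Continuous fun g₂ : 𝒢₂.Adelic => f (g₂, a₁) :=
  hf.comp (Continuous.prodMk_left a₁)

/-- A slice `g₁ ↦ f(a₂, g₁)` of a continuous `f` is continuous (the slices `f_{γ₁}` of Rogawski (1990), §4.9). [cite: Rogawski1990, §4.9 pp. 54–55] -/
theorem continuous_slice_right {f : 𝒢₂.Adelic × 𝒢₁.Adelic → ℂ} (hf : Continuous f) (a₂ : 𝒢₂.Adelic) :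
    Continuous fun g₁ : 𝒢₁.Adelic => f (a₂, g₁) :=
  hf.comp (Continuous.prodMk_right a₂)

/-- **Slices of a compactly supported function are compactly supported**: `g₂ ↦ (g₂, a₁)` is a closed
embedding (the second factor is Hausdorff, so points are closed), and compact support pulls back along closed
embeddings (the slices `f_{γ₁} ∈ C_c` of Rogawski (1990), §4.9). [cite: Rogawski1990, §4.9 pp. 54–55] -/
theorem hasCompactSupport_slice_left [T1Space 𝒢₁.Adelic] {f : 𝒢₂.Adelic × 𝒢₁.Adelic → ℂ}
    (hf : HasCompactSupport f) (a₁ : 𝒢₁.Adelic) :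
    HasCompactSupport fun g₂ : 𝒢₂.Adelic => f (g₂, a₁) := by
  have hg : IsClosedEmbedding fun g₂ : 𝒢₂.Adelic => (g₂, a₁) :=
    ⟨isEmbedding_prodMkLeft a₁, (isClosedMap_prodMk_right a₁).isClosed_range⟩
  exact hf.comp_isClosedEmbedding hg

/-- The same for the slices `g₁ ↦ f(a₂, g₁)` in the second variable. [cite: Rogawski1990, §4.9 pp. 54–55] -/
theorem hasCompactSupport_slice_right [T1Space 𝒢₂.Adelic] {f : 𝒢₂.Adelic × 𝒢₁.Adelic → ℂ}
    (hf : HasCompactSupport f) (a₂ : 𝒢₂.Adelic) :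
    HasCompactSupport fun g₁ : 𝒢₁.Adelic => f (a₂, g₁) := by
  have hg : IsClosedEmbedding fun g₁ : 𝒢₁.Adelic => (a₂, g₁) :=
    ⟨isEmbedding_prodMkRight a₂, (isClosedMap_prodMk_left a₂).isClosed_range⟩
  exact hf.comp_isClosedEmbedding hg

/-- **Only finitely many rational `γ₁ ∈ G₁(F)` carry a non-zero slice `f(·, x₁⁻¹ γ₁ y₁)`** when `f` has
compact support on `G₂(𝔸) × G₁(𝔸)` and `G₁(F)` is discrete: a non-zero slice forces `x₁⁻¹ γ₁ y₁` into the
compact projection `snd(tsupport f)`, and §1 applies on the second factor (Rogawski (1990), §2.2 p. 13;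
Gelbart (1975), (9.20)). [cite: Rogawski1990, §2.2 (p. 13)] [cite: Gelbart1975, (9.20)] -/
theorem finite_setOf_slice_ne_zero (h₁ : 𝒢₁.IsDiscreteRational) [T2Space 𝒢₁.Adelic]
    {f : 𝒢₂.Adelic × 𝒢₁.Adelic → ℂ} (hf : HasCompactSupport f) (x₁ y₁ : 𝒢₁.Adelic) :
    {γ₁ : 𝒢₁.arithmeticSubgroup |
      (fun g₂ : 𝒢₂.Adelic => f (g₂, x₁⁻¹ * (γ₁ : 𝒢₁.Adelic) * y₁)) ≠ 0}.Finite := by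
  refine (finite_setOf_conj_mem_of_isCompact h₁ (hf.image continuous_snd) x₁ y₁).subset fun γ₁ hγ₁ => ?_
  obtain ⟨g₂, hg₂⟩ := Function.ne_iff.1 hγ₁
  exact ⟨(g₂, x₁⁻¹ * (γ₁ : 𝒢₁.Adelic) * y₁), subset_tsupport _ hg₂, rfl⟩

/-! ## §3 The kernel sum over `G₂(F) × G₁(F)` is a finite sum of slice kernel sums -/

/-- **The pair kernel family has finite support**: for `f` of compact support on `G₂(𝔸) × G₁(𝔸)` (both rational
groups discrete, both adelic groups Hausdorff), `(γ₂, γ₁) ↦ f(x₂⁻¹ γ₂ y₂, x₁⁻¹ γ₁ y₁)` vanishes off a finite set —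
§1 for the product datum spelled out on the two factors. [cite: Rogawski1990, §2.2 (p. 13)] [cite: Gelbart1975, (9.20)] -/
theorem finite_support_pair_term (h₂ : 𝒢₂.IsDiscreteRational) (h₁ : 𝒢₁.IsDiscreteRational)
    [T2Space 𝒢₂.Adelic] [T2Space 𝒢₁.Adelic] {f : 𝒢₂.Adelic × 𝒢₁.Adelic → ℂ} (hf : HasCompactSupport f)
    (x₂ y₂ : 𝒢₂.Adelic) (x₁ y₁ : 𝒢₁.Adelic) :
    (Function.support fun γ : 𝒢₂.arithmeticSubgroup × 𝒢₁.arithmeticSubgroup =>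
      f (x₂⁻¹ * (γ.1 : 𝒢₂.Adelic) * y₂, x₁⁻¹ * (γ.2 : 𝒢₁.Adelic) * y₁)).Finite := by
  have hA := finite_setOf_conj_mem_of_isCompact h₂ (hf.image continuous_fst) x₂ y₂
  have hB := finite_setOf_conj_mem_of_isCompact h₁ (hf.image continuous_snd) x₁ y₁
  refine (hA.prod hB).subset fun γ hγ => ?_
  have hmem : (x₂⁻¹ * (γ.1 : 𝒢₂.Adelic) * y₂, x₁⁻¹ * (γ.2 : 𝒢₁.Adelic) * y₁) ∈ tsupport f :=
    subset_tsupport _ hγ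
  exact ⟨⟨_, hmem, rfl⟩, ⟨_, hmem, rfl⟩⟩

/-- Hence the pair kernel family is summable (honestly: it has finite support). [cite: Rogawski1990, §2.2 (p. 13)] -/
theorem summable_pair_term (h₂ : 𝒢₂.IsDiscreteRational) (h₁ : 𝒢₁.IsDiscreteRational)
    [T2Space 𝒢₂.Adelic] [T2Space 𝒢₁.Adelic] {f : 𝒢₂.Adelic × 𝒢₁.Adelic → ℂ} (hf : HasCompactSupport f)
    (x₂ y₂ : 𝒢₂.Adelic) (x₁ y₁ : 𝒢₁.Adelic) :
    Summable fun γ : 𝒢₂.arithmeticSubgroup × 𝒢₁.arithmeticSubgroup =>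
      f (x₂⁻¹ * (γ.1 : 𝒢₂.Adelic) * y₂, x₁⁻¹ * (γ.2 : 𝒢₁.Adelic) * y₁) :=
  summable_of_hasFiniteSupport (finite_support_pair_term h₂ h₁ hf x₂ y₂ x₁ y₁)

/-- Each slice kernel family `γ₂ ↦ f(x₂⁻¹ γ₂ y₂, a₁)` is summable (finite support, ★ §1 on the first factor).
[cite: Rogawski1990, §2.2 (p. 13)] -/
theorem summable_slice_term (h₂ : 𝒢₂.IsDiscreteRational) [T2Space 𝒢₂.Adelic] [T1Space 𝒢₁.Adelic]
    {f : 𝒢₂.Adelic × 𝒢₁.Adelic → ℂ} (hf : HasCompactSupport f) (x₂ y₂ : 𝒢₂.Adelic) (a₁ : 𝒢₁.Adelic) :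
    Summable fun γ₂ : 𝒢₂.arithmeticSubgroup => f (x₂⁻¹ * (γ₂ : 𝒢₂.Adelic) * y₂, a₁) := by
  refine summable_of_hasFiniteSupport
    ((finite_setOf_conj_mem_of_isCompact h₂ (hasCompactSupport_slice_left hf a₁) x₂ y₂).subset
      fun γ₂ hγ₂ => ?_)
  exact subset_tsupport _ hγ₂

/-- **The kernel sum of the pair is a finite sum of slice kernel sums**:
`Σ'_{(γ₂, γ₁) ∈ G₂(F) × G₁(F)} f(x₂⁻¹ γ₂ y₂, x₁⁻¹ γ₁ y₁) = Σ_{γ₁ ∈ S₁} Σ'_{γ₂ ∈ G₂(F)} f(x₂⁻¹ γ₂ y₂, x₁⁻¹ γ₁ y₁)`, the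
outer sum over the finite set `S₁` of `γ₁` with a non-zero slice (`finite_setOf_slice_ne_zero`), every sum honest
(Rogawski (1990), §2.2 p. 13: «the sums over `γ` are finite»; the `H = U(2) × U(1)` bookkeeping of §4.9).
[cite: Rogawski1990, §2.2 (p. 13)] [cite: Gelbart1975, (9.20)] -/
theorem tsum_pair_eq_sum_tsum_slice (h₂ : 𝒢₂.IsDiscreteRational) (h₁ : 𝒢₁.IsDiscreteRational)
    [T2Space 𝒢₂.Adelic] [T2Space 𝒢₁.Adelic] {f : 𝒢₂.Adelic × 𝒢₁.Adelic → ℂ} (hf : HasCompactSupport f)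
    (x₂ y₂ : 𝒢₂.Adelic) (x₁ y₁ : 𝒢₁.Adelic) :
    ∑' γ : 𝒢₂.arithmeticSubgroup × 𝒢₁.arithmeticSubgroup,
        f (x₂⁻¹ * (γ.1 : 𝒢₂.Adelic) * y₂, x₁⁻¹ * (γ.2 : 𝒢₁.Adelic) * y₁) =
      ∑ γ₁ ∈ (finite_setOf_slice_ne_zero h₁ hf x₁ y₁).toFinset,
        ∑' γ₂ : 𝒢₂.arithmeticSubgroup,
          f (x₂⁻¹ * (γ₂ : 𝒢₂.Adelic) * y₂, x₁⁻¹ * (γ₁ : 𝒢₁.Adelic) * y₁) := by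
  classical
  set T := (finite_support_pair_term h₂ h₁ hf x₂ y₂ x₁ y₁).toFinset with hT
  set S₁ := (finite_setOf_slice_ne_zero (𝒢₂ := 𝒢₂) h₁ hf x₁ y₁).toFinset with hS₁
  -- the pair family vanishes off `T.image fst ×ˢ S₁`
  have hvan : ∀ γ : 𝒢₂.arithmeticSubgroup × 𝒢₁.arithmeticSubgroup, γ ∉ T.image Prod.fst ×ˢ S₁ →
      f (x₂⁻¹ * (γ.1 : 𝒢₂.Adelic) * y₂, x₁⁻¹ * (γ.2 : 𝒢₁.Adelic) * y₁) = 0 := by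
    intro γ hγ
    by_contra hne
    apply hγ
    refine Finset.mem_product.2 ⟨Finset.mem_image.2 ⟨γ, ?_, rfl⟩, ?_⟩
    · exact (Set.Finite.mem_toFinset _).2 (Function.mem_support.2 hne)
    · refine (Set.Finite.mem_toFinset _).2 ?_
      exact Function.ne_iff.2 ⟨x₂⁻¹ * (γ.1 : 𝒢₂.Adelic) * y₂, hne⟩
  rw [tsum_eq_sum hvan, Finset.sum_product_right]
  refine Finset.sum_congr rfl fun γ₁ _ => ?_
  -- each inner finite sum is the honest `tsum` of the slice family
  refine (tsum_eq_sum fun γ₂ hγ₂ => ?_).symm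
  by_contra hne
  exact hγ₂ (Finset.mem_image.2 ⟨(γ₂, γ₁), (Set.Finite.mem_toFinset _).2 (Function.mem_support.2 hne), rfl⟩)

/-- **Commutative second factor**: if `G₁(𝔸)` is commutative (the compact torus `U(Φ₁)`), then
`x₁⁻¹ γ₁ x₁ = γ₁` and the DIAGONAL pair kernel is `Σ_{γ₁ ∈ S₁} Σ'_{γ₂} f(x₂⁻¹ γ₂ y₂, γ₁)` — census item 8:
`K_H((x₂,x₁),(y₂,x₁)) = Σ_{γ₁} K_{G₂}[f_{γ₁}](x₂, y₂)` (Rogawski (1990), §4.9: the `U(1)` factor of `H` is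
compact abelian). [cite: Rogawski1990, §2.2 (p. 13)] [cite: Rogawski1990, §4.9 pp. 54–55] -/
theorem tsum_pair_eq_sum_tsum_slice_of_comm (h₂ : 𝒢₂.IsDiscreteRational) (h₁ : 𝒢₁.IsDiscreteRational)
    [T2Space 𝒢₂.Adelic] [T2Space 𝒢₁.Adelic] (hcomm : ∀ a b : 𝒢₁.Adelic, a * b = b * a)
    {f : 𝒢₂.Adelic × 𝒢₁.Adelic → ℂ} (hf : HasCompactSupport f) (x₂ y₂ : 𝒢₂.Adelic) (x₁ : 𝒢₁.Adelic) :
    ∑' γ : 𝒢₂.arithmeticSubgroup × 𝒢₁.arithmeticSubgroup,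
        f (x₂⁻¹ * (γ.1 : 𝒢₂.Adelic) * y₂, x₁⁻¹ * (γ.2 : 𝒢₁.Adelic) * x₁) =
      ∑ γ₁ ∈ (finite_setOf_slice_ne_zero h₁ hf x₁ x₁).toFinset,
        ∑' γ₂ : 𝒢₂.arithmeticSubgroup, f (x₂⁻¹ * (γ₂ : 𝒢₂.Adelic) * y₂, (γ₁ : 𝒢₁.Adelic)) := by
  have hconj : ∀ γ₁ : 𝒢₁.arithmeticSubgroup, x₁⁻¹ * (γ₁ : 𝒢₁.Adelic) * x₁ = γ₁ := fun γ₁ => by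
    rw [hcomm x₁⁻¹, mul_assoc, hcomm x₁⁻¹, mul_inv_cancel, ← hcomm, one_mul]
  rw [tsum_pair_eq_sum_tsum_slice h₂ h₁ hf x₂ y₂ x₁ x₁]
  exact Finset.sum_congr rfl fun γ₁ _ => by simp_rw [hconj γ₁]

/-- The finite index set of the commutative form does not depend on the base point: with `x₁⁻¹ γ₁ x₁ = γ₁`,
`γ₁ ∈ S₁(x₁) ↔ f(·, γ₁) ≠ 0`. [cite: Rogawski1990, §4.9 pp. 54–55] -/
theorem mem_toFinset_slice_ne_zero_of_comm (h₁ : 𝒢₁.IsDiscreteRational) [T2Space 𝒢₁.Adelic]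
    (hcomm : ∀ a b : 𝒢₁.Adelic, a * b = b * a) {f : 𝒢₂.Adelic × 𝒢₁.Adelic → ℂ} (hf : HasCompactSupport f)
    (x₁ : 𝒢₁.Adelic) (γ₁ : 𝒢₁.arithmeticSubgroup) :
    γ₁ ∈ (finite_setOf_slice_ne_zero (𝒢₂ := 𝒢₂) h₁ hf x₁ x₁).toFinset ↔
      (fun g₂ : 𝒢₂.Adelic => f (g₂, (γ₁ : 𝒢₁.Adelic))) ≠ 0 := by
  have hconj : x₁⁻¹ * (γ₁ : 𝒢₁.Adelic) * x₁ = γ₁ := by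
    rw [hcomm x₁⁻¹, mul_assoc, hcomm x₁⁻¹, mul_inv_cancel, ← hcomm, one_mul]
  rw [Set.Finite.mem_toFinset, Set.mem_setOf_eq, hconj]

end AdelicGroupData

/-! ## §4 The pair `U(J_N) × U(Φ₁)` over a CM field: slices in the `kernel` currency -/

namespace UnitaryGroup

variable (L : Type) [Field L] [NumberField L] [IsCMField L] (N : ℕ) (Φ₁ : Matrix (Fin 1) (Fin 1) L)

/-- **The diagonal kernel of `U(J_N) × U(Φ₁)` is the finite sum of the `U(J_N)`-kernels of the slices**:
for `f ∈ C_c(U(J_N)(𝔸_{L⁺}) × U(Φ₁)(𝔸_{L⁺}))`,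
`Σ'_{(γ₂, γ₁) ∈ U(J_N)(L⁺) × U(Φ₁)(L⁺)} f(x₂⁻¹ γ₂ y₂, x₁⁻¹ γ₁ x₁) = Σ_{γ₁ ∈ S₁} K[f(·, γ₁)](x₂, y₂)` with ★
`UnitaryGroup.kernel` (`K[φ](x, y) = Σ'_{γ ∈ G(F)} φ(x⁻¹ γ y)`) and `S₁` the finite set of `γ₁ ∈ U(Φ₁)(L⁺)` with
`f(·, γ₁) ≠ 0` — `U(Φ₁)(𝔸)` is commutative (★ `cmDatum_one_mul_comm`), `U(J_N)(L⁺)` and `U(Φ₁)(L⁺)` are discrete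
(★ `isDiscreteRational_quasiSplit`, ★ `cmDatum_isDiscreteRational`). This is the `γ₁`-bookkeeping by which every
trace-formula law for `H = U(Φ₂) × U(Φ₁)` reduces to the law for `U(Φ₂)` slice by slice (Rogawski (1990), §4.9).
[cite: Rogawski1990, §2.2 (p. 13)] [cite: Rogawski1990, §4.9 pp. 54–55] -/
theorem tsum_pair_eq_sum_kernel_slice
    {f : (quasiSplit (↥(maximalRealSubfield L)) L (IsCMField.complexConj L) N).Adelic × (cmDatum L 1 Φ₁).Adelic → ℂ}
    (hf : HasCompactSupport f)
    (x₂ y₂ : (quasiSplit (↥(maximalRealSubfield L)) L (IsCMField.complexConj L) N).Adelic)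
    (x₁ : (cmDatum L 1 Φ₁).Adelic) :
    ∑' γ : (quasiSplit (↥(maximalRealSubfield L)) L (IsCMField.complexConj L) N).arithmeticSubgroup ×
        (cmDatum L 1 Φ₁).arithmeticSubgroup,
        f (x₂⁻¹ * (γ.1 : (quasiSplit (↥(maximalRealSubfield L)) L (IsCMField.complexConj L) N).Adelic) * y₂,
          x₁⁻¹ * (γ.2 : (cmDatum L 1 Φ₁).Adelic) * x₁) =
      ∑ γ₁ ∈ (AdelicGroupData.finite_setOf_slice_ne_zero
          (𝒢₂ := quasiSplit (↥(maximalRealSubfield L)) L (IsCMField.complexConj L) N)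
          (cmDatum_isDiscreteRational L 1 Φ₁) hf x₁ x₁).toFinset,
        kernel (fun g₂ => f (g₂, (γ₁ : (cmDatum L 1 Φ₁).Adelic))) x₂ y₂ := by
  haveI : T2Space (quasiSplit (↥(maximalRealSubfield L)) L (IsCMField.complexConj L) N).Adelic :=
    t2Space_cmDatum_Adelic L N ((StdForm.antidiagonal N).over L)
  simp only [kernel_def]
  exact AdelicGroupData.tsum_pair_eq_sum_tsum_slice_of_comm isDiscreteRational_quasiSplit
    (cmDatum_isDiscreteRational L 1 Φ₁) (cmDatum_one_mul_comm L Φ₁) hf x₂ y₂ x₁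

/-- **The slices of a pair test function are compactly supported and continuous on `U(J_N)(𝔸)`**, so each
`K[f(·, γ₁)]` above is itself an honest finite kernel sum (★ `kernel_eq_sum`). [cite: Rogawski1990, §2.2 (p. 13)] -/
theorem hasCompactSupport_continuous_slice
    {f : (quasiSplit (↥(maximalRealSubfield L)) L (IsCMField.complexConj L) N).Adelic × (cmDatum L 1 Φ₁).Adelic → ℂ}
    (hf : HasCompactSupport f) (hfc : Continuous f) (a₁ : (cmDatum L 1 Φ₁).Adelic) :
    HasCompactSupport
        (fun g₂ : (quasiSplit (↥(maximalRealSubfield L)) L (IsCMField.complexConj L) N).Adelic => f (g₂, a₁)) ∧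
      Continuous
        (fun g₂ : (quasiSplit (↥(maximalRealSubfield L)) L (IsCMField.complexConj L) N).Adelic => f (g₂, a₁)) :=
  ⟨AdelicGroupData.hasCompactSupport_slice_left hf a₁, AdelicGroupData.continuous_slice_left hfc a₁⟩

end UnitaryGroup

end Literature.NumberTheory.Automorphic
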